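import Literature.AlgebraicTopology.KTheory.Collapse
import Mathlib.Analysis.InnerProductSpace.PiL2
import Mathlib.Analysis.InnerProductSpace.ProdL2
import Mathlib.Analysis.Normed.Lp.ProdLp
import Mathlib.Analysis.SpecialFunctions.Sqrt
import Mathlib.Topology.Homotopy.Contractible
import Mathlib.Analysis.Convex.Contractible
import HarnessLib

/-!
# The mapping cone of the Hopf construction (Hatcher, *VBKT* §2.3, Lemma 2.18)

For a continuous "multiplication" `g : S^{d-1} × S^{d-1} → S^{d-1}` (`S^{d-1} ⊆ ℝᵈ` the round unit
sphere) Hatcher's **Hopf construction** is the map `ĝ : ∂(Dᵈ × Dᵈ) → Sᵈ`,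
`ĝ(x, y) = |y| g(x, y/|y|) ∈ D₊` on `∂Dᵈ × Dᵈ`, `ĝ(x, y) = |x| g(x/|x|, y) ∈ D₋` on `Dᵈ × ∂Dᵈ`,
and the **mapping cone** `C_ĝ = Sᵈ ∪_ĝ (Dᵈ × Dᵈ)` carries the `K`-theory used in the Adams–Atiyah
proof of Hopf invariant one (Hatcher, *Vector Bundles and K-Theory*, §2.3, proof of Lemma 2.18).
This file builds `C_ĝ` as a **compact Hausdorff space** without adjunction-space quotients:

* §1 the signed square root `ssqrt x = √x - √(-x)`;
* §2 the bidisc `DD d = Dᵈ × Dᵈ` with its sup-radius `rad`, the unit direction `udir`;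
* §3 the extended Hopf construction
  `θ₂(a, b) = (min(|a|,|b|) · g(a/|a|, b/|b|), ssqrt(|a|² - |b|²)) ∈ ℝᵈ × ℝ` (Euclidean norm
  `‖θ₂(a,b)‖ = rad (a,b)`, and `θ₂ = ĝ` on the boundary), `θ₁(w) = (1 - rad w) · w`,
  `Θ = (θ₁, θ₂)`, which is injective off the boundary and depends only on `ĝ` on it;
* §4 **the cone** `Cone g e₀ := range Θ ∪ ({0} × Sᵈ)` (a compact subspace of a Euclidean space),
  the characteristic map `conePhi : DD d → Cone`, the inclusion `coneJ : Sᵈ → Cone` of the bottom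
  sphere, the description of points, and **descent of continuous maps** along the quotient map
  `DD ⊔ Sᵈ → Cone` (`coneLift`);
* §5 `Collapse (DD d) ∂ ≃ₜ Collapse Cone Sᵈ` (`coneCollapseHomeo`), the pair maps
  `(DD, ∂D × D) → (C, D₊)`, `(DD, D × ∂D) → (C, D₋)`;
* §6 the hemispheres `D± ⊆ Sᵈ`, their images in the cone, and their contractibility.

Everything is proved; no named facts. The `K`-theory of the cone (exact sequence, the classes
`α, β`) is developed in `MappingConeK.lean` and `HopfInvariantOne.lean`.

## References

* A. Hatcher, *Vector Bundles and K-Theory* (v2.2, 2017), §2.3, Lemma 2.18 and its proof (the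
  map `ĝ`, the cone `C_ĝ`, the characteristic map `Φ` of the `2n`-cell... here `4n`-cell
  `D^{2n} × D^{2n}`). [HatcherVBKT2017]
* A. Hatcher, *Algebraic Topology* (2002), Ch. 0 (mapping cones, CW pairs). [HatcherAT2002]

## Design notes

* The bottom sphere is the unit sphere of the Euclidean space `WithLp 2 (ℝᵈ × ℝ)`, so that the
  hemispheres are `{± t ≥ 0}` and the Hopf construction needs no coordinates.
* `C_ĝ` is realised as the image of `DD ⊔ Sᵈ` in `(ℝᵈ × ℝᵈ) × (ℝᵈ × ℝ)` under an injective-on-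
  classes continuous map; being a continuous image of a compact space inside a Hausdorff space it
  *is* the quotient (`coneLift`), and no separation argument for adjunction spaces is needed.
-/

noncomputable section

namespace Literature.AlgebraicTopology.KTheory

open Set Metric TopologicalSpace Filter Topology

/-! ### 1. The signed square root -/

section SSqrt

/-- The **signed square root** `ssqrt x = sign(x) √|x|`, written as `√x - √(-x)`. [folklore] -/
def ssqrt (x : ℝ) : ℝ := Real.sqrt x - Real.sqrt (-x)

/-- Mapping cone of the Hopf construction (Hatcher VBKT §2.3). [folklore] -/
theorem continuous_ssqrt : Continuous ssqrt :=
  Real.continuous_sqrt.sub (Real.continuous_sqrt.comp continuous_neg)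

/-- Mapping cone of the Hopf construction (Hatcher VBKT §2.3). [folklore] -/
theorem ssqrt_of_nonneg {x : ℝ} (hx : 0 ≤ x) : ssqrt x = Real.sqrt x := by
  rw [ssqrt, Real.sqrt_eq_zero'.2 (neg_nonpos.2 hx), sub_zero]

/-- Mapping cone of the Hopf construction (Hatcher VBKT §2.3). [folklore] -/
theorem ssqrt_of_nonpos {x : ℝ} (hx : x ≤ 0) : ssqrt x = -Real.sqrt (-x) := by
  rw [ssqrt, Real.sqrt_eq_zero'.2 hx, zero_sub]

/-- Mapping cone of the Hopf construction (Hatcher VBKT §2.3). [folklore] -/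
theorem ssqrt_nonneg_iff {x : ℝ} : 0 ≤ ssqrt x ↔ 0 ≤ x := by
  constructor
  · intro h
    by_contra hx
    push Not at hx
    rw [ssqrt_of_nonpos hx.le] at h
    have : 0 < Real.sqrt (-x) := Real.sqrt_pos.2 (neg_pos.2 hx)
    linarith
  · intro h; rw [ssqrt_of_nonneg h]; exact Real.sqrt_nonneg _

/-- Mapping cone of the Hopf construction (Hatcher VBKT §2.3). [folklore] -/
theorem ssqrt_nonpos_iff {x : ℝ} : ssqrt x ≤ 0 ↔ x ≤ 0 := by
  constructor
  · intro h
    by_contra hx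
    push Not at hx
    rw [ssqrt_of_nonneg hx.le] at h
    have : 0 < Real.sqrt x := Real.sqrt_pos.2 hx
    linarith
  · intro h; rw [ssqrt_of_nonpos h, neg_nonpos]; exact Real.sqrt_nonneg _

/-- `(ssqrt x)² = |x|`. [folklore] -/
theorem ssqrt_sq (x : ℝ) : ssqrt x ^ 2 = |x| := by
  rcases le_total 0 x with hx | hx
  · rw [ssqrt_of_nonneg hx, Real.sq_sqrt hx, abs_of_nonneg hx]
  · rw [ssqrt_of_nonpos hx, neg_sq, Real.sq_sqrt (neg_nonneg.2 hx), abs_of_nonpos hx]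

end SSqrt

/-! ### 2. The bidisc `Dᵈ × Dᵈ` -/

section Bidisc

variable (d : ℕ)

/-- `ℝᵈ`. [folklore] -/
abbrev Vd : Type := EuclideanSpace ℝ (Fin d)

/-- The round unit sphere `S^{d-1} ⊆ ℝᵈ`. [folklore] -/
abbrev Sd1 : Type := ↥(sphere (0 : Vd d) 1)

/-- The closed unit disc `Dᵈ ⊆ ℝᵈ`. [folklore] -/
abbrev Dd : Type := ↥(closedBall (0 : Vd d) 1)

/-- The bidisc `Dᵈ × Dᵈ` (the `2d`-cell of the mapping cone). [cite: HatcherVBKT2017, §2.3 Lemma 2.18] -/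
abbrev DD : Type := Dd d × Dd d

/-- `ℝᵈ × ℝ` with its Euclidean norm. [folklore] -/
abbrev Wd : Type := WithLp 2 (Vd d × ℝ)

/-- The round unit `d`-sphere `Sᵈ ⊆ ℝᵈ × ℝ` (the bottom cell of the mapping cone). [cite: HatcherVBKT2017, §2.3 Lemma 2.18] -/
abbrev SW : Type := ↥(sphere (0 : Wd d) 1)

variable {d}

/-- The sup-radius `max(|a|, |b|)` of a point of the bidisc. [folklore] -/
def rad (w : DD d) : ℝ := max ‖(w.1 : Vd d)‖ ‖(w.2 : Vd d)‖

/-- Mapping cone of the Hopf construction (Hatcher VBKT §2.3). [folklore] -/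
theorem continuous_rad : Continuous (rad : DD d → ℝ) :=
  (continuous_norm.comp (continuous_subtype_val.comp continuous_fst)).max
    (continuous_norm.comp (continuous_subtype_val.comp continuous_snd))

/-- Mapping cone of the Hopf construction (Hatcher VBKT §2.3). [folklore] -/
theorem norm_fst_le_one (w : DD d) : ‖(w.1 : Vd d)‖ ≤ 1 := mem_closedBall_zero_iff.1 w.1.2

/-- Mapping cone of the Hopf construction (Hatcher VBKT §2.3). [folklore] -/
theorem norm_snd_le_one (w : DD d) : ‖(w.2 : Vd d)‖ ≤ 1 := mem_closedBall_zero_iff.1 w.2.2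

/-- Mapping cone of the Hopf construction (Hatcher VBKT §2.3). [folklore] -/
theorem rad_nonneg (w : DD d) : 0 ≤ rad w := le_max_of_le_left (norm_nonneg _)

/-- Mapping cone of the Hopf construction (Hatcher VBKT §2.3). [folklore] -/
theorem rad_le_one (w : DD d) : rad w ≤ 1 := max_le (norm_fst_le_one w) (norm_snd_le_one w)

/-- Mapping cone of the Hopf construction (Hatcher VBKT §2.3). [folklore] -/
theorem norm_fst_le_rad (w : DD d) : ‖(w.1 : Vd d)‖ ≤ rad w := le_max_left _ _

/-- Mapping cone of the Hopf construction (Hatcher VBKT §2.3). [folklore] -/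
theorem norm_snd_le_rad (w : DD d) : ‖(w.2 : Vd d)‖ ≤ rad w := le_max_right _ _

/-- The boundary `∂(Dᵈ × Dᵈ) = {max(|a|,|b|) = 1}`. [cite: HatcherVBKT2017, §2.3 Lemma 2.18] -/
def bdry (d : ℕ) : Set (DD d) := {w | rad w = 1}

/-- Mapping cone of the Hopf construction (Hatcher VBKT §2.3). [folklore] -/
theorem mem_bdry {w : DD d} : w ∈ bdry d ↔ rad w = 1 := Iff.rfl

/-- Mapping cone of the Hopf construction (Hatcher VBKT §2.3). [folklore] -/
theorem isClosed_bdry : IsClosed (bdry d) := isClosed_eq continuous_rad continuous_const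

/-- `∂(Dᵈ × Dᵈ)` as a closed set. [cite: HatcherVBKT2017, §2.3 Lemma 2.18] -/
def bdryC (d : ℕ) : Closeds (DD d) := ⟨bdry d, isClosed_bdry⟩

/-- Mapping cone of the Hopf construction (Hatcher VBKT §2.3). [folklore] -/
@[simp] theorem coe_bdryC : ((bdryC d : Closeds (DD d)) : Set (DD d)) = bdry d := rfl

/-- The face `∂Dᵈ × Dᵈ = {|a| = 1}`. [cite: HatcherVBKT2017, §2.3 Lemma 2.18] -/
def faceA (d : ℕ) : Set (DD d) := {w | ‖(w.1 : Vd d)‖ = 1}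

/-- The face `Dᵈ × ∂Dᵈ = {|b| = 1}`. [cite: HatcherVBKT2017, §2.3 Lemma 2.18] -/
def faceB (d : ℕ) : Set (DD d) := {w | ‖(w.2 : Vd d)‖ = 1}

/-- Mapping cone of the Hopf construction (Hatcher VBKT §2.3). [folklore] -/
theorem isClosed_faceA : IsClosed (faceA d) :=
  isClosed_eq (continuous_norm.comp (continuous_subtype_val.comp continuous_fst)) continuous_const

/-- Mapping cone of the Hopf construction (Hatcher VBKT §2.3). [folklore] -/
theorem isClosed_faceB : IsClosed (faceB d) :=
  isClosed_eq (continuous_norm.comp (continuous_subtype_val.comp continuous_snd)) continuous_const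

/-- Mapping cone of the Hopf construction (Hatcher VBKT §2.3). [folklore] -/
theorem rad_eq_one_of_mem_faceA {w : DD d} (hw : w ∈ faceA d) : rad w = 1 :=
  le_antisymm (rad_le_one w) (by rw [← show ‖(w.1 : Vd d)‖ = 1 from hw]; exact norm_fst_le_rad w)

/-- Mapping cone of the Hopf construction (Hatcher VBKT §2.3). [folklore] -/
theorem rad_eq_one_of_mem_faceB {w : DD d} (hw : w ∈ faceB d) : rad w = 1 :=
  le_antisymm (rad_le_one w) (by rw [← show ‖(w.2 : Vd d)‖ = 1 from hw]; exact norm_snd_le_rad w)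

/-- Mapping cone of the Hopf construction (Hatcher VBKT §2.3). [folklore] -/
theorem bdry_eq_faceA_union_faceB : bdry d = faceA d ∪ faceB d := by
  ext w
  simp only [mem_bdry, mem_union, faceA, faceB, mem_setOf_eq, rad]
  constructor
  · intro h
    rcases le_total ‖(w.1 : Vd d)‖ ‖(w.2 : Vd d)‖ with h1 | h1
    · right; rwa [max_eq_right h1] at h
    · left; rwa [max_eq_left h1] at h
  · rintro (h | h)
    · exact le_antisymm (max_le (norm_fst_le_one w) (norm_snd_le_one w)) (h.symm.le.trans (le_max_left _ _))
    · exact le_antisymm (max_le (norm_fst_le_one w) (norm_snd_le_one w)) (h.symm.le.trans (le_max_right _ _))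

/-! #### Unit directions -/

variable (e₀ : Sd1 d)

/-- The unit direction `a/|a|` (a fixed point `e₀` of the sphere at `a = 0`), as a vector. [folklore] -/
def udirV (a : Vd d) : Vd d := if a = 0 then (e₀ : Vd d) else ‖a‖⁻¹ • a

/-- Mapping cone of the Hopf construction (Hatcher VBKT §2.3). [folklore] -/
theorem norm_udirV (a : Vd d) : ‖udirV e₀ a‖ = 1 := by
  unfold udirV
  split_ifs with h
  · exact mem_sphere_zero_iff_norm.1 e₀.2
  · rw [norm_smul, norm_inv, norm_norm, inv_mul_cancel₀ (norm_ne_zero_iff.2 h)]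

/-- The unit direction `a/|a|` as a point of `S^{d-1}`. [folklore] -/
def udir (a : Vd d) : Sd1 d := ⟨udirV e₀ a, mem_sphere_zero_iff_norm.2 (norm_udirV e₀ a)⟩

/-- Mapping cone of the Hopf construction (Hatcher VBKT §2.3). [folklore] -/
theorem udir_of_ne_zero {a : Vd d} (ha : a ≠ 0) : (udir e₀ a : Vd d) = ‖a‖⁻¹ • a := by
  change udirV e₀ a = _; rw [udirV, if_neg ha]

/-- Mapping cone of the Hopf construction (Hatcher VBKT §2.3). [folklore] -/
theorem continuousAt_udir {a : Vd d} (ha : a ≠ 0) : ContinuousAt (udir e₀) a := by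
  rw [IsInducing.subtypeVal.continuousAt_iff]
  change ContinuousAt (udirV e₀) a
  have h : (fun x : Vd d ↦ ‖x‖⁻¹ • x) =ᶠ[𝓝 a] udirV e₀ := by
    filter_upwards [isOpen_ne.mem_nhds ha] with x hx
    rw [udirV, if_neg hx]
  exact ((continuous_norm.continuousAt.inv₀ (norm_ne_zero_iff.2 ha)).smul continuousAt_id).congr h

end Bidisc

/-! ### 3. The extended Hopf construction `θ₂` and the map `Θ` -/

section Theta

variable {d : ℕ} (g : C(Sd1 d × Sd1 d, Sd1 d)) (e₀ : Sd1 d)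

/-- `min(|a|,|b|) · g(a/|a|, b/|b|)`, the vector part of the extended Hopf construction. [cite: HatcherVBKT2017, §2.3 Lemma 2.18] -/
def hopfVec (w : DD d) : Vd d := (min ‖(w.1 : Vd d)‖ ‖(w.2 : Vd d)‖) • (g (udir e₀ w.1, udir e₀ w.2) : Vd d)

/-- Mapping cone of the Hopf construction (Hatcher VBKT §2.3). [folklore] -/
theorem norm_hopfVec (w : DD d) : ‖hopfVec g e₀ w‖ = min ‖(w.1 : Vd d)‖ ‖(w.2 : Vd d)‖ := by
  rw [hopfVec, norm_smul, Real.norm_of_nonneg (le_min (norm_nonneg _) (norm_nonneg _)),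
    mem_sphere_zero_iff_norm.1 (g _).2, mul_one]

/-- Mapping cone of the Hopf construction (Hatcher VBKT §2.3). [folklore] -/
theorem continuous_minNorm : Continuous (fun w : DD d ↦ min ‖(w.1 : Vd d)‖ ‖(w.2 : Vd d)‖) :=
  (continuous_norm.comp (continuous_subtype_val.comp continuous_fst)).min
    (continuous_norm.comp (continuous_subtype_val.comp continuous_snd))

/-- The extended Hopf construction is continuous (at points with `a = 0` or `b = 0` its norm is
squeezed by `min(|a|,|b|)`). [cite: HatcherVBKT2017, §2.3 Lemma 2.18] -/
theorem continuous_hopfVec : Continuous (hopfVec g e₀) := by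
  rw [continuous_iff_continuousAt]
  intro w
  by_cases h : (w.1 : Vd d) ≠ 0 ∧ (w.2 : Vd d) ≠ 0
  · apply ContinuousAt.smul continuous_minNorm.continuousAt
    have h1 : ContinuousAt (fun w : DD d ↦ (udir e₀ (w.1 : Vd d), udir e₀ (w.2 : Vd d))) w :=
      (ContinuousAt.comp (f := fun w : DD d ↦ (w.1 : Vd d)) (continuousAt_udir e₀ h.1)
          (continuous_subtype_val.comp continuous_fst).continuousAt).prodMk
        (ContinuousAt.comp (f := fun w : DD d ↦ (w.2 : Vd d)) (continuousAt_udir e₀ h.2)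
          (continuous_subtype_val.comp continuous_snd).continuousAt)
    exact continuous_subtype_val.continuousAt.comp (g.continuous.continuousAt.comp h1)
  · have hw : min ‖(w.1 : Vd d)‖ ‖(w.2 : Vd d)‖ = 0 := by
      rw [not_and_or, not_not, not_not] at h
      rcases h with h | h
      · rw [h, norm_zero, min_eq_left (norm_nonneg _)]
      · rw [h, norm_zero, min_eq_right (norm_nonneg _)]
    have h0 : hopfVec g e₀ w = 0 := by rw [hopfVec, hw, zero_smul]
    rw [ContinuousAt, h0]
    refine squeeze_zero_norm (fun w' ↦ (norm_hopfVec g e₀ w').le) ?_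
    have := continuous_minNorm.tendsto w
    rwa [hw] at this

/-- **The extended Hopf construction** `θ₂(a,b) = (min(|a|,|b|) g(â, b̂), ssqrt(|a|² - |b|²))`;
on `|a| = 1 ≥ |b|` this is the point `|b| g(a, b̂)` of the upper hemisphere, on `|b| = 1 ≥ |a|`
the point `|a| g(â, b)` of the lower hemisphere (Hatcher's `ĝ`), and in general
`‖θ₂(a,b)‖ = max(|a|,|b|)`. [cite: HatcherVBKT2017, §2.3 Lemma 2.18] -/
def theta2 (w : DD d) : Wd d :=
  WithLp.toLp 2 (hopfVec g e₀ w, ssqrt (‖(w.1 : Vd d)‖ ^ 2 - ‖(w.2 : Vd d)‖ ^ 2))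

/-- Mapping cone of the Hopf construction (Hatcher VBKT §2.3). [folklore] -/
theorem theta2_fst (w : DD d) : (theta2 g e₀ w).fst = hopfVec g e₀ w := rfl

/-- Mapping cone of the Hopf construction (Hatcher VBKT §2.3). [folklore] -/
theorem theta2_snd (w : DD d) : (theta2 g e₀ w).snd = ssqrt (‖(w.1 : Vd d)‖ ^ 2 - ‖(w.2 : Vd d)‖ ^ 2) := rfl

/-- Mapping cone of the Hopf construction (Hatcher VBKT §2.3). [folklore] -/
theorem continuous_theta2 : Continuous (theta2 g e₀) :=
  (WithLp.prod_continuous_toLp 2 (Vd d) ℝ).comp ((continuous_hopfVec g e₀).prodMk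
    (continuous_ssqrt.comp (((continuous_norm.comp (continuous_subtype_val.comp continuous_fst)).pow 2).sub
      ((continuous_norm.comp (continuous_subtype_val.comp continuous_snd)).pow 2))))

/-- `min(x,y)² + |x² - y²| = max(x,y)²` for `x, y ≥ 0`. [folklore] -/
theorem min_sq_add_abs_sq_sub_sq {x y : ℝ} (hx : 0 ≤ x) (hy : 0 ≤ y) : min x y ^ 2 + |x ^ 2 - y ^ 2| = max x y ^ 2 := by
  rcases le_total x y with h | h
  · rw [min_eq_left h, max_eq_right h, abs_of_nonpos (sub_nonpos.2 (pow_le_pow_left₀ hx h 2))]; ring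
  · rw [min_eq_right h, max_eq_left h, abs_of_nonneg (sub_nonneg.2 (pow_le_pow_left₀ hy h 2))]; ring

/-- **`‖θ₂(w)‖ = rad w`.** [cite: HatcherVBKT2017, §2.3 Lemma 2.18] -/
theorem norm_theta2 (w : DD d) : ‖theta2 g e₀ w‖ = rad w := by
  have h : ‖theta2 g e₀ w‖ ^ 2 = rad w ^ 2 := by
    rw [WithLp.prod_norm_sq_eq_of_L2, theta2_fst, theta2_snd, norm_hopfVec, Real.norm_eq_abs, sq_abs, ssqrt_sq,
      rad, min_sq_add_abs_sq_sub_sq (norm_nonneg _) (norm_nonneg _)]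
  exact (sq_eq_sq₀ (norm_nonneg _) (rad_nonneg w)).1 h

/-- `θ₁(w) = (1 - rad w) · w`. [cite: HatcherVBKT2017, §2.3 Lemma 2.18] -/
def theta1 (w : DD d) : Vd d × Vd d := (1 - rad w) • ((w.1 : Vd d), (w.2 : Vd d))

/-- Mapping cone of the Hopf construction (Hatcher VBKT §2.3). [folklore] -/
theorem continuous_theta1 : Continuous (theta1 : DD d → Vd d × Vd d) :=
  (continuous_const.sub continuous_rad).smul
    ((continuous_subtype_val.comp continuous_fst).prodMk (continuous_subtype_val.comp continuous_snd))

/-- Mapping cone of the Hopf construction (Hatcher VBKT §2.3). [folklore] -/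
theorem theta1_eq_zero_of_rad_eq_one {w : DD d} (h : rad w = 1) : theta1 w = 0 := by
  rw [theta1, h, sub_self, zero_smul]

/-- **`Θ = (θ₁, θ₂) : Dᵈ × Dᵈ → (ℝᵈ × ℝᵈ) × (ℝᵈ × ℝ)`.** [cite: HatcherVBKT2017, §2.3 Lemma 2.18] -/
def Theta (w : DD d) : (Vd d × Vd d) × Wd d := (theta1 w, theta2 g e₀ w)

/-- Mapping cone of the Hopf construction (Hatcher VBKT §2.3). [folklore] -/
theorem continuous_Theta : Continuous (Theta g e₀) := continuous_theta1.prodMk (continuous_theta2 g e₀)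

/-- On the boundary, `Θ(w) = (0, θ₂ w)`. [cite: HatcherVBKT2017, §2.3 Lemma 2.18] -/
theorem Theta_eq_of_rad_eq_one {w : DD d} (h : rad w = 1) : Theta g e₀ w = (0, theta2 g e₀ w) := by
  rw [Theta, theta1_eq_zero_of_rad_eq_one h]

/-- `Θ` is injective off the boundary. [cite: HatcherVBKT2017, §2.3 Lemma 2.18] -/
theorem eq_of_Theta_eq {w w' : DD d} (hw : rad w < 1) (h : Theta g e₀ w = Theta g e₀ w') : w = w' := by
  have h2 : theta2 g e₀ w = theta2 g e₀ w' := congrArg Prod.snd h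
  have hr : rad w = rad w' := by rw [← norm_theta2 g e₀ w, ← norm_theta2 g e₀ w', h2]
  have h1 : theta1 w = theta1 w' := congrArg Prod.fst h
  rw [theta1, theta1, ← hr] at h1
  have h1' := smul_right_injective (Vd d × Vd d) (sub_ne_zero.2 (ne_of_gt hw)) h1
  obtain ⟨ha, hb⟩ := Prod.mk.inj h1'
  exact Prod.ext (Subtype.ext ha) (Subtype.ext hb)

/-- A point with `Θ(w) = (0, p)` lies on the boundary as soon as `‖p‖ = 1`. [cite: HatcherVBKT2017, §2.3 Lemma 2.18] -/
theorem rad_eq_one_of_Theta_eq {w : DD d} {p : Wd d} (hp : ‖p‖ = 1) (h : Theta g e₀ w = (0, p)) : rad w = 1 := by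
  have h2 : theta2 g e₀ w = p := congrArg Prod.snd h
  rw [← norm_theta2 g e₀ w, h2, hp]

end Theta

/-! ### 4. The mapping cone as a compact subspace -/

section Cone

variable {d : ℕ} (g : C(Sd1 d × Sd1 d, Sd1 d)) (e₀ : Sd1 d)

/-- The inclusion of the bottom sphere `p ↦ (0, p)`. [folklore] -/
def botIncl (d : ℕ) : SW d → (Vd d × Vd d) × Wd d := fun p ↦ (0, (p : Wd d))

/-- Mapping cone of the Hopf construction (Hatcher VBKT §2.3). [folklore] -/
theorem continuous_botIncl : Continuous (botIncl d) := continuous_const.prodMk continuous_subtype_val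

/-- Mapping cone of the Hopf construction (Hatcher VBKT §2.3). [folklore] -/
theorem botIncl_injective : Function.Injective (botIncl d) := fun _ _ h ↦ Subtype.ext (congrArg Prod.snd h)

/-- **The mapping cone `C_ĝ`** of the Hopf construction, as the compact subspace
`Θ(Dᵈ × Dᵈ) ∪ ({0} × Sᵈ)` of `(ℝᵈ × ℝᵈ) × (ℝᵈ × ℝ)`. [cite: HatcherVBKT2017, §2.3 Lemma 2.18] -/
def coneSet : Set ((Vd d × Vd d) × Wd d) := range (Theta g e₀) ∪ range (botIncl d)

/-- The mapping cone `C_ĝ` as a type. [cite: HatcherVBKT2017, §2.3 Lemma 2.18] -/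
abbrev Cone : Type := ↥(coneSet g e₀)

/-- Mapping cone of the Hopf construction (Hatcher VBKT §2.3). [folklore] -/
theorem isCompact_coneSet : IsCompact (coneSet g e₀) :=
  (isCompact_range (continuous_Theta g e₀)).union (isCompact_range continuous_botIncl)

/-- Mapping cone of the Hopf construction (Hatcher VBKT §2.3). -/
instance compactSpace_cone : CompactSpace (Cone g e₀) := isCompact_iff_compactSpace.1 (isCompact_coneSet g e₀)

/-- The characteristic map `Φ : Dᵈ × Dᵈ → C_ĝ` of the top cell. [cite: HatcherVBKT2017, §2.3 Lemma 2.18] -/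
def conePhi : C(DD d, Cone g e₀) :=
  ⟨fun w ↦ ⟨Theta g e₀ w, Or.inl ⟨w, rfl⟩⟩, (continuous_Theta g e₀).subtype_mk _⟩

/-- The inclusion `j : Sᵈ → C_ĝ` of the bottom cell. [cite: HatcherVBKT2017, §2.3 Lemma 2.18] -/
def coneJ : C(SW d, Cone g e₀) :=
  ⟨fun p ↦ ⟨botIncl d p, Or.inr ⟨p, rfl⟩⟩, continuous_botIncl.subtype_mk _⟩

/-- Mapping cone of the Hopf construction (Hatcher VBKT §2.3). [folklore] -/
@[simp] theorem coe_conePhi (w : DD d) : ((conePhi g e₀ w : Cone g e₀) : (Vd d × Vd d) × Wd d) = Theta g e₀ w := rfl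

/-- Mapping cone of the Hopf construction (Hatcher VBKT §2.3). [folklore] -/
@[simp] theorem coe_coneJ (p : SW d) : ((coneJ g e₀ p : Cone g e₀) : (Vd d × Vd d) × Wd d) = botIncl d p := rfl

/-- Mapping cone of the Hopf construction (Hatcher VBKT §2.3). [folklore] -/
theorem coneJ_injective : Function.Injective (coneJ g e₀) := fun _ _ h ↦
  botIncl_injective (congrArg Subtype.val h)

/-- The boundary value `θ₂(w) ∈ Sᵈ` of a boundary point. [cite: HatcherVBKT2017, §2.3 Lemma 2.18] -/
def bdryVal (w : DD d) (hw : rad w = 1) : SW d := ⟨theta2 g e₀ w, mem_sphere_zero_iff_norm.2 (by rw [norm_theta2, hw])⟩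

/-- Mapping cone of the Hopf construction (Hatcher VBKT §2.3). [folklore] -/
@[simp] theorem coe_bdryVal (w : DD d) (hw : rad w = 1) : (bdryVal g e₀ w hw : Wd d) = theta2 g e₀ w := rfl

/-- **On the boundary, `Φ = j ∘ ĝ`.** [cite: HatcherVBKT2017, §2.3 Lemma 2.18] -/
theorem conePhi_eq_coneJ {w : DD d} (hw : rad w = 1) : conePhi g e₀ w = coneJ g e₀ (bdryVal g e₀ w hw) :=
  Subtype.ext (Theta_eq_of_rad_eq_one g e₀ hw)

/-- Mapping cone of the Hopf construction (Hatcher VBKT §2.3). [folklore] -/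
theorem rad_eq_one_of_conePhi_eq_coneJ {w : DD d} {p : SW d} (h : conePhi g e₀ w = coneJ g e₀ p) : rad w = 1 :=
  rad_eq_one_of_Theta_eq g e₀ (mem_sphere_zero_iff_norm.1 p.2) (congrArg Subtype.val h)

/-- Mapping cone of the Hopf construction (Hatcher VBKT §2.3). [folklore] -/
theorem conePhi_mem_range_coneJ_iff {w : DD d} : conePhi g e₀ w ∈ range (coneJ g e₀) ↔ rad w = 1 :=
  ⟨fun ⟨_, hp⟩ ↦ rad_eq_one_of_conePhi_eq_coneJ g e₀ hp.symm, fun h ↦ ⟨_, (conePhi_eq_coneJ g e₀ h).symm⟩⟩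

/-- Mapping cone of the Hopf construction (Hatcher VBKT §2.3). [folklore] -/
theorem conePhi_injective_of_lt {w w' : DD d} (hw : rad w < 1) (h : conePhi g e₀ w = conePhi g e₀ w') : w = w' :=
  eq_of_Theta_eq g e₀ hw (congrArg Subtype.val h)

/-- **Points of the cone**: an interior point of the top cell, or a point of the bottom sphere. [cite: HatcherVBKT2017, §2.3 Lemma 2.18] -/
theorem cone_cases (c : Cone g e₀) : (∃ w, rad w < 1 ∧ c = conePhi g e₀ w) ∨ (∃ p, c = coneJ g e₀ p) := by
  obtain ⟨c, hc | ⟨p, rfl⟩⟩ := c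
  · obtain ⟨w, rfl⟩ := hc
    rcases (rad_le_one w).lt_or_eq with h | h
    · exact Or.inl ⟨w, h, rfl⟩
    · exact Or.inr ⟨bdryVal g e₀ w h, conePhi_eq_coneJ g e₀ h⟩
  · exact Or.inr ⟨p, rfl⟩

/-- The quotient map `Dᵈ × Dᵈ ⊔ Sᵈ → C_ĝ`. [cite: HatcherVBKT2017, §2.3 Lemma 2.18] -/
def coneQuot : DD d ⊕ SW d → Cone g e₀ := Sum.elim (conePhi g e₀) (coneJ g e₀)

/-- Mapping cone of the Hopf construction (Hatcher VBKT §2.3). [folklore] -/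
theorem continuous_coneQuot : Continuous (coneQuot g e₀) :=
  (conePhi g e₀).continuous.sumElim (coneJ g e₀).continuous

/-- Mapping cone of the Hopf construction (Hatcher VBKT §2.3). [folklore] -/
theorem coneQuot_surjective : Function.Surjective (coneQuot g e₀) := by
  intro c
  rcases cone_cases g e₀ c with ⟨w, -, rfl⟩ | ⟨p, rfl⟩
  · exact ⟨Sum.inl w, rfl⟩
  · exact ⟨Sum.inr p, rfl⟩

/-- `Dᵈ × Dᵈ ⊔ Sᵈ → C_ĝ` is a quotient map (a continuous surjection from a compact space to a
Hausdorff space). [cite: HatcherAT2002, Ch. 0] -/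
theorem isQuotientMap_coneQuot : IsQuotientMap (coneQuot g e₀) :=
  (continuous_coneQuot g e₀).isClosedMap.isQuotientMap (continuous_coneQuot g e₀) (coneQuot_surjective g e₀)

variable {M : Type*} [TopologicalSpace M]

/-- The set-theoretic descent of a compatible pair of maps to the cone. [folklore] -/
def coneLiftFun (fD : DD d → M) (fS : SW d → M) (c : Cone g e₀) : M :=
  haveI := Classical.dec ((c : (Vd d × Vd d) × Wd d) ∈ range (botIncl d))
  if h : (c : (Vd d × Vd d) × Wd d) ∈ range (botIncl d) then fS (Classical.choose h)
  else fD (Classical.choose (c.2.resolve_right h))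

omit [TopologicalSpace M] in
/-- Mapping cone of the Hopf construction (Hatcher VBKT §2.3). [folklore] -/
theorem coneLiftFun_coneJ (fD : DD d → M) (fS : SW d → M) (p : SW d) : coneLiftFun g e₀ fD fS (coneJ g e₀ p) = fS p := by
  have h : ((coneJ g e₀ p : Cone g e₀) : (Vd d × Vd d) × Wd d) ∈ range (botIncl d) := ⟨p, rfl⟩
  rw [coneLiftFun, dif_pos h]
  congr 1
  exact botIncl_injective (Classical.choose_spec h)

omit [TopologicalSpace M] in
/-- Mapping cone of the Hopf construction (Hatcher VBKT §2.3). [folklore] -/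
theorem coneLiftFun_conePhi (fD : DD d → M) (fS : SW d → M) (hcompat : ∀ w (hw : rad w = 1), fD w = fS (bdryVal g e₀ w hw))
    (w : DD d) : coneLiftFun g e₀ fD fS (conePhi g e₀ w) = fD w := by
  by_cases h : ((conePhi g e₀ w : Cone g e₀) : (Vd d × Vd d) × Wd d) ∈ range (botIncl d)
  · rw [coneLiftFun, dif_pos h]
    have hp := Classical.choose_spec h
    -- `Θ w = (0, p)` forces `rad w = 1` and `p = θ₂ w`
    have hw : rad w = 1 := rad_eq_one_of_Theta_eq g e₀ (mem_sphere_zero_iff_norm.1 (Classical.choose h).2) hp.symm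
    rw [hcompat w hw]
    congr 1
    apply Subtype.ext
    have h2 := congrArg Prod.snd hp
    exact h2.trans (congrArg Prod.snd (Theta_eq_of_rad_eq_one g e₀ hw))
  · rw [coneLiftFun, dif_neg h]
    set w₁ := Classical.choose ((conePhi g e₀ w).2.resolve_right h) with hw₁
    have hw' : Theta g e₀ w₁ = Theta g e₀ w := Classical.choose_spec ((conePhi g e₀ w).2.resolve_right h)
    -- both `w` and the chosen preimage are interior points with the same image
    have hlt : rad w₁ < 1 := by
      rcases (rad_le_one w₁).lt_or_eq with hl | he
      · exact hl
      · exfalso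
        apply h
        refine ⟨bdryVal g e₀ w₁ he, ?_⟩
        change ((0 : Vd d × Vd d), theta2 g e₀ w₁) = Theta g e₀ w
        rw [← hw', Theta_eq_of_rad_eq_one g e₀ he]
    exact congrArg fD (eq_of_Theta_eq g e₀ hlt hw')

/-- **Descent to the cone**: a continuous map on `Dᵈ × Dᵈ` and a continuous map on `Sᵈ` which
agree along `ĝ` on the boundary define a continuous map on `C_ĝ`. [cite: HatcherAT2002, Ch. 0] -/
def coneLift (fD : C(DD d, M)) (fS : C(SW d, M)) (hcompat : ∀ w (hw : rad w = 1), fD w = fS (bdryVal g e₀ w hw)) : C(Cone g e₀, M) where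
  toFun := coneLiftFun g e₀ fD fS
  continuous_toFun := by
    rw [(isQuotientMap_coneQuot g e₀).continuous_iff]
    have h : coneLiftFun g e₀ fD fS ∘ coneQuot g e₀ = Sum.elim fD fS := by
      funext x
      rcases x with w | p
      · exact coneLiftFun_conePhi g e₀ fD fS hcompat w
      · exact coneLiftFun_coneJ g e₀ fD fS p
    rw [h]
    exact fD.continuous.sumElim fS.continuous

/-- Mapping cone of the Hopf construction (Hatcher VBKT §2.3). [folklore] -/
@[simp] theorem coneLift_conePhi (fD : C(DD d, M)) (fS : C(SW d, M)) (hcompat) (w : DD d) :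
    coneLift g e₀ fD fS hcompat (conePhi g e₀ w) = fD w := coneLiftFun_conePhi g e₀ fD fS hcompat w

/-- Mapping cone of the Hopf construction (Hatcher VBKT §2.3). [folklore] -/
@[simp] theorem coneLift_coneJ (fD : C(DD d, M)) (fS : C(SW d, M)) (hcompat) (p : SW d) :
    coneLift g e₀ fD fS hcompat (coneJ g e₀ p) = fS p := coneLiftFun_coneJ g e₀ fD fS p

omit [TopologicalSpace M] in
/-- Maps out of the cone are determined by their compositions with `Φ` and `j`. [folklore] -/
theorem cone_hom_ext {F F' : Cone g e₀ → M} (hD : ∀ w, F (conePhi g e₀ w) = F' (conePhi g e₀ w))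
    (hS : ∀ p, F (coneJ g e₀ p) = F' (coneJ g e₀ p)) : F = F' := by
  funext c
  rcases cone_cases g e₀ c with ⟨w, -, rfl⟩ | ⟨p, rfl⟩
  · exact hD w
  · exact hS p

end Cone

/-! ### 5. Collapsing the bottom sphere: `C_ĝ/Sᵈ ≅ (Dᵈ × Dᵈ)/∂` -/

section CollapseCone

variable {d : ℕ} (g : C(Sd1 d × Sd1 d, Sd1 d)) (e₀ : Sd1 d)

/-- The bottom sphere `Sᵈ ⊆ C_ĝ`. [cite: HatcherVBKT2017, §2.3 Lemma 2.18] -/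
def coneS : Set (Cone g e₀) := range (coneJ g e₀)

/-- Mapping cone of the Hopf construction (Hatcher VBKT §2.3). [folklore] -/
theorem isClosed_coneS : IsClosed (coneS g e₀) := (isCompact_range (coneJ g e₀).continuous).isClosed

/-- The bottom sphere as a closed set. [cite: HatcherVBKT2017, §2.3 Lemma 2.18] -/
def coneSC : Closeds (Cone g e₀) := ⟨coneS g e₀, isClosed_coneS g e₀⟩

/-- Mapping cone of the Hopf construction (Hatcher VBKT §2.3). [folklore] -/
@[simp] theorem coe_coneSC : ((coneSC g e₀ : Closeds (Cone g e₀)) : Set (Cone g e₀)) = coneS g e₀ := rfl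

/-- Mapping cone of the Hopf construction (Hatcher VBKT §2.3). [folklore] -/
theorem coneJ_mem_coneS (p : SW d) : coneJ g e₀ p ∈ coneS g e₀ := ⟨p, rfl⟩

/-- Mapping cone of the Hopf construction (Hatcher VBKT §2.3). [folklore] -/
theorem mapsTo_conePhi_bdry : MapsTo (conePhi g e₀) (bdryC d : Set (DD d)) (coneSC g e₀ : Set (Cone g e₀)) :=
  fun _ hw ↦ (conePhi_mem_range_coneJ_iff g e₀).2 hw

/-- `Φ̄ : (Dᵈ × Dᵈ)/∂ → C_ĝ/Sᵈ`. [cite: HatcherVBKT2017, §2.3 Lemma 2.18] -/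
def coneCollapseMap : C(Collapse (DD d) (bdryC d), Collapse (Cone g e₀) (coneSC g e₀)) :=
  Collapse.map (conePhi g e₀) (mapsTo_conePhi_bdry g e₀)

/-- Mapping cone of the Hopf construction (Hatcher VBKT §2.3). [folklore] -/
theorem coneCollapseMap_bijective : Function.Bijective (coneCollapseMap g e₀) := by
  constructor
  · intro a b h
    rcases Collapse.eq_pt_or_eq_mk a with rfl | ⟨w, hw, rfl⟩ <;> rcases Collapse.eq_pt_or_eq_mk b with rfl | ⟨w', hw', rfl⟩
    · rfl
    · exfalso
      rw [coneCollapseMap, Collapse.map_pt, Collapse.map_mk, eq_comm, Collapse.mk_eq_pt_iff] at h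
      exact hw' ((conePhi_mem_range_coneJ_iff g e₀).1 h)
    · exfalso
      rw [coneCollapseMap, Collapse.map_pt, Collapse.map_mk, Collapse.mk_eq_pt_iff] at h
      exact hw ((conePhi_mem_range_coneJ_iff g e₀).1 h)
    · rw [coneCollapseMap, Collapse.map_mk, Collapse.map_mk, Collapse.mk_eq_mk_iff] at h
      rcases h with h | ⟨h, -⟩
      · rw [conePhi_injective_of_lt g e₀ (lt_of_le_of_ne (rad_le_one w) hw) h]
      · exact absurd ((conePhi_mem_range_coneJ_iff g e₀).1 h) hw
  · intro c
    rcases Collapse.eq_pt_or_eq_mk c with rfl | ⟨c, hc, rfl⟩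
    · exact ⟨Collapse.pt _, rfl⟩
    · rcases cone_cases g e₀ c with ⟨w, -, rfl⟩ | ⟨p, rfl⟩
      · exact ⟨Collapse.mk _ w, rfl⟩
      · exact absurd (coneJ_mem_coneS g e₀ p) hc

/-- **`(Dᵈ × Dᵈ)/∂(Dᵈ × Dᵈ) ≃ₜ C_ĝ/Sᵈ`** (the top cell of the cone). [cite: HatcherVBKT2017, §2.3 Lemma 2.18] -/
def coneCollapseHomeo : Collapse (DD d) (bdryC d) ≃ₜ Collapse (Cone g e₀) (coneSC g e₀) :=
  Continuous.homeoOfEquivCompactToT2 (f := Equiv.ofBijective _ (coneCollapseMap_bijective g e₀)) (coneCollapseMap g e₀).continuous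

/-- Mapping cone of the Hopf construction (Hatcher VBKT §2.3). [folklore] -/
@[simp] theorem coneCollapseHomeo_apply (z : Collapse (DD d) (bdryC d)) : coneCollapseHomeo g e₀ z = coneCollapseMap g e₀ z := rfl

/-- Mapping cone of the Hopf construction (Hatcher VBKT §2.3). [folklore] -/
theorem coe_coneCollapseHomeo :
    ((coneCollapseHomeo g e₀ : Collapse (DD d) (bdryC d) ≃ₜ Collapse (Cone g e₀) (coneSC g e₀)) :
      C(Collapse (DD d) (bdryC d), Collapse (Cone g e₀) (coneSC g e₀))) = coneCollapseMap g e₀ := rfl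

/-- Mapping cone of the Hopf construction (Hatcher VBKT §2.3). [folklore] -/
theorem coneCollapseMap_comp_mk : (coneCollapseMap g e₀).comp (Collapse.mk (bdryC d)) = (Collapse.mk (coneSC g e₀)).comp (conePhi g e₀) := rfl

end CollapseCone

/-! ### 6. Hemispheres and their images in the cone -/

section Hemispheres

variable {d : ℕ} (g : C(Sd1 d × Sd1 d, Sd1 d)) (e₀ : Sd1 d)

/-- The upper hemisphere `D₊ = {t ≥ 0} ⊆ Sᵈ`. [cite: HatcherVBKT2017, §2.3 Lemma 2.18] -/
def hemiUp (d : ℕ) : Set (SW d) := {p | 0 ≤ (p : Wd d).snd}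

/-- The lower hemisphere `D₋ = {t ≤ 0} ⊆ Sᵈ`. [cite: HatcherVBKT2017, §2.3 Lemma 2.18] -/
def hemiDn (d : ℕ) : Set (SW d) := {p | (p : Wd d).snd ≤ 0}

/-- Mapping cone of the Hopf construction (Hatcher VBKT §2.3). [folklore] -/
theorem isClosed_hemiUp : IsClosed (hemiUp d) :=
  isClosed_le continuous_const ((WithLp.continuous_snd 2 (Vd d) ℝ).comp continuous_subtype_val)

/-- Mapping cone of the Hopf construction (Hatcher VBKT §2.3). [folklore] -/
theorem isClosed_hemiDn : IsClosed (hemiDn d) :=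
  isClosed_le ((WithLp.continuous_snd 2 (Vd d) ℝ).comp continuous_subtype_val) continuous_const

/-- Mapping cone of the Hopf construction (Hatcher VBKT §2.3). [folklore] -/
theorem hemiUp_union_hemiDn : hemiUp d ∪ hemiDn d = univ := by
  ext p; simp only [mem_union, hemiUp, hemiDn, mem_setOf_eq, mem_univ, iff_true]; exact le_total _ _

/-- `D₊ ⊆ C_ĝ`. [cite: HatcherVBKT2017, §2.3 Lemma 2.18] -/
def coneDup : Set (Cone g e₀) := coneJ g e₀ '' hemiUp d

/-- `D₋ ⊆ C_ĝ`. [cite: HatcherVBKT2017, §2.3 Lemma 2.18] -/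
def coneDdn : Set (Cone g e₀) := coneJ g e₀ '' hemiDn d

/-- Mapping cone of the Hopf construction (Hatcher VBKT §2.3). [folklore] -/
theorem isClosed_coneDup : IsClosed (coneDup g e₀) :=
  ((isClosed_hemiUp (d := d)).isCompact.image (coneJ g e₀).continuous).isClosed

/-- Mapping cone of the Hopf construction (Hatcher VBKT §2.3). [folklore] -/
theorem isClosed_coneDdn : IsClosed (coneDdn g e₀) :=
  ((isClosed_hemiDn (d := d)).isCompact.image (coneJ g e₀).continuous).isClosed

/-- `D₊ ⊆ C_ĝ` as a closed set. [cite: HatcherVBKT2017, §2.3 Lemma 2.18] -/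
def coneDupC : Closeds (Cone g e₀) := ⟨coneDup g e₀, isClosed_coneDup g e₀⟩

/-- `D₋ ⊆ C_ĝ` as a closed set. [cite: HatcherVBKT2017, §2.3 Lemma 2.18] -/
def coneDdnC : Closeds (Cone g e₀) := ⟨coneDdn g e₀, isClosed_coneDdn g e₀⟩

/-- Mapping cone of the Hopf construction (Hatcher VBKT §2.3). [folklore] -/
@[simp] theorem coe_coneDupC : ((coneDupC g e₀ : Closeds (Cone g e₀)) : Set (Cone g e₀)) = coneDup g e₀ := rfl

/-- Mapping cone of the Hopf construction (Hatcher VBKT §2.3). [folklore] -/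
@[simp] theorem coe_coneDdnC : ((coneDdnC g e₀ : Closeds (Cone g e₀)) : Set (Cone g e₀)) = coneDdn g e₀ := rfl

/-- Mapping cone of the Hopf construction (Hatcher VBKT §2.3). [folklore] -/
theorem coneDup_union_coneDdn : coneDup g e₀ ∪ coneDdn g e₀ = coneS g e₀ := by
  rw [coneDup, coneDdn, ← image_union, hemiUp_union_hemiDn, image_univ]; rfl

/-- Mapping cone of the Hopf construction (Hatcher VBKT §2.3). [folklore] -/
theorem coneDup_subset_coneS : coneDup g e₀ ⊆ coneS g e₀ := by rw [← coneDup_union_coneDdn]; exact subset_union_left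

/-- Mapping cone of the Hopf construction (Hatcher VBKT §2.3). [folklore] -/
theorem coneDdn_subset_coneS : coneDdn g e₀ ⊆ coneS g e₀ := by rw [← coneDup_union_coneDdn]; exact subset_union_right

/-- **`Φ` maps the face `∂Dᵈ × Dᵈ` into `D₊`** (there `θ₂ = (|b| g(a, b̂), √(1 - |b|²))`). [cite: HatcherVBKT2017, §2.3 Lemma 2.18] -/
theorem mapsTo_conePhi_faceA : MapsTo (conePhi g e₀) (faceA d) (coneDupC g e₀ : Set (Cone g e₀)) := by
  intro w hw
  have hr := rad_eq_one_of_mem_faceA hw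
  refine ⟨bdryVal g e₀ w hr, ?_, (conePhi_eq_coneJ g e₀ hr).symm⟩
  change 0 ≤ (theta2 g e₀ w).snd
  rw [theta2_snd, ssqrt_nonneg_iff, show ‖(w.1 : Vd d)‖ = 1 from hw, one_pow, sub_nonneg]
  exact pow_le_one₀ (norm_nonneg _) (norm_snd_le_one w)

/-- **`Φ` maps the face `Dᵈ × ∂Dᵈ` into `D₋`.** [cite: HatcherVBKT2017, §2.3 Lemma 2.18] -/
theorem mapsTo_conePhi_faceB : MapsTo (conePhi g e₀) (faceB d) (coneDdnC g e₀ : Set (Cone g e₀)) := by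
  intro w hw
  have hr := rad_eq_one_of_mem_faceB hw
  refine ⟨bdryVal g e₀ w hr, ?_, (conePhi_eq_coneJ g e₀ hr).symm⟩
  change (theta2 g e₀ w).snd ≤ 0
  rw [theta2_snd, ssqrt_nonpos_iff, show ‖(w.2 : Vd d)‖ = 1 from hw, one_pow, sub_nonpos]
  exact pow_le_one₀ (norm_nonneg _) (norm_fst_le_one w)

/-! #### Contractibility of the hemispheres -/

/-- The height `√(1 - |v|²)` of the hemisphere over a point of the disc. [folklore] -/
def hgt (v : Dd d) : ℝ := Real.sqrt (1 - ‖(v : Vd d)‖ ^ 2)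

/-- Mapping cone of the Hopf construction (Hatcher VBKT §2.3). [folklore] -/
theorem continuous_hgt : Continuous (hgt : Dd d → ℝ) :=
  Real.continuous_sqrt.comp (continuous_const.sub ((continuous_norm.comp continuous_subtype_val).pow 2))

/-- Mapping cone of the Hopf construction (Hatcher VBKT §2.3). [folklore] -/
theorem hgt_nonneg (v : Dd d) : 0 ≤ hgt v := Real.sqrt_nonneg _

/-- Mapping cone of the Hopf construction (Hatcher VBKT §2.3). [folklore] -/
theorem hgt_sq (v : Dd d) : hgt v ^ 2 = 1 - ‖(v : Vd d)‖ ^ 2 :=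
  Real.sq_sqrt (sub_nonneg.2 (pow_le_one₀ (norm_nonneg _) (mem_closedBall_zero_iff.1 v.2)))

/-- Mapping cone of the Hopf construction (Hatcher VBKT §2.3). [folklore] -/
theorem norm_fst_le_one_of_mem_sphere (p : SW d) : ‖(p : Wd d).fst‖ ≤ 1 := by
  have h := WithLp.prod_norm_sq_eq_of_L2 (p : Wd d)
  rw [mem_sphere_zero_iff_norm.1 p.2, one_pow] at h
  nlinarith [sq_nonneg ‖(p : Wd d).snd‖, norm_nonneg (p : Wd d).fst]

/-- The projection `D₊ → Dᵈ`, `(v, t) ↦ v`. [folklore] -/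
def hemiUpToDisc : C(↥(hemiUp d), Dd d) :=
  ⟨fun p ↦ ⟨((p : SW d) : Wd d).fst, mem_closedBall_zero_iff.2 (norm_fst_le_one_of_mem_sphere p.1)⟩,
    (((WithLp.continuous_fst 2 (Vd d) ℝ).comp continuous_subtype_val).comp continuous_subtype_val).subtype_mk _⟩

/-- The section `Dᵈ → D₊`, `v ↦ (v, √(1 - |v|²))`. [folklore] -/
def discToHemiUp : C(Dd d, ↥(hemiUp d)) :=
  ⟨fun v ↦ ⟨⟨WithLp.toLp 2 ((v : Vd d), hgt v), mem_sphere_zero_iff_norm.2 (by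
      have h : ‖WithLp.toLp 2 ((v : Vd d), hgt v)‖ ^ 2 = 1 := by
        rw [WithLp.prod_norm_sq_eq_of_L2, WithLp.toLp_fst, WithLp.toLp_snd, Real.norm_eq_abs, sq_abs, hgt_sq]; ring
      exact (sq_eq_sq₀ (norm_nonneg _) zero_le_one).1 (by rw [one_pow]; exact h))⟩, hgt_nonneg v⟩,
    (((WithLp.prod_continuous_toLp 2 (Vd d) ℝ).comp (continuous_subtype_val.prodMk continuous_hgt)).subtype_mk _).subtype_mk _⟩

/-- The projection `D₋ → Dᵈ`. [folklore] -/
def hemiDnToDisc : C(↥(hemiDn d), Dd d) :=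
  ⟨fun p ↦ ⟨((p : SW d) : Wd d).fst, mem_closedBall_zero_iff.2 (norm_fst_le_one_of_mem_sphere p.1)⟩,
    (((WithLp.continuous_fst 2 (Vd d) ℝ).comp continuous_subtype_val).comp continuous_subtype_val).subtype_mk _⟩

/-- The section `Dᵈ → D₋`, `v ↦ (v, -√(1 - |v|²))`. [folklore] -/
def discToHemiDn : C(Dd d, ↥(hemiDn d)) :=
  ⟨fun v ↦ ⟨⟨WithLp.toLp 2 ((v : Vd d), -hgt v), mem_sphere_zero_iff_norm.2 (by
      have h : ‖WithLp.toLp 2 ((v : Vd d), -hgt v)‖ ^ 2 = 1 := by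
        rw [WithLp.prod_norm_sq_eq_of_L2, WithLp.toLp_fst, WithLp.toLp_snd, Real.norm_eq_abs, sq_abs, neg_sq, hgt_sq]; ring
      exact (sq_eq_sq₀ (norm_nonneg _) zero_le_one).1 (by rw [one_pow]; exact h))⟩, neg_nonpos.2 (hgt_nonneg v)⟩,
    (((WithLp.prod_continuous_toLp 2 (Vd d) ℝ).comp (continuous_subtype_val.prodMk continuous_hgt.neg)).subtype_mk _).subtype_mk _⟩

/-- Mapping cone of the Hopf construction (Hatcher VBKT §2.3). [folklore] -/
theorem snd_eq_hgt_of_mem_hemiUp (p : ↥(hemiUp d)) : ((p : SW d) : Wd d).snd = hgt (hemiUpToDisc p) := by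
  have h := WithLp.prod_norm_sq_eq_of_L2 ((p : SW d) : Wd d)
  rw [mem_sphere_zero_iff_norm.1 p.1.2, one_pow, Real.norm_eq_abs, sq_abs] at h
  have h2 : ((p : SW d) : Wd d).snd ^ 2 = hgt (hemiUpToDisc p) ^ 2 := by
    rw [hgt_sq]; change _ = 1 - ‖((p : SW d) : Wd d).fst‖ ^ 2; linarith
  exact (sq_eq_sq₀ p.2 (hgt_nonneg _)).1 h2

/-- Mapping cone of the Hopf construction (Hatcher VBKT §2.3). [folklore] -/
theorem snd_eq_neg_hgt_of_mem_hemiDn (p : ↥(hemiDn d)) : ((p : SW d) : Wd d).snd = -hgt (hemiDnToDisc p) := by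
  have h := WithLp.prod_norm_sq_eq_of_L2 ((p : SW d) : Wd d)
  rw [mem_sphere_zero_iff_norm.1 p.1.2, one_pow, Real.norm_eq_abs, sq_abs] at h
  have h2 : (-((p : SW d) : Wd d).snd) ^ 2 = hgt (hemiDnToDisc p) ^ 2 := by
    rw [neg_sq, hgt_sq]; change _ = 1 - ‖((p : SW d) : Wd d).fst‖ ^ 2; linarith
  have h3 := (sq_eq_sq₀ (neg_nonneg.2 p.2) (hgt_nonneg _)).1 h2
  linarith

/-- **`D₊ ≃ₜ Dᵈ`.** [folklore] -/
def hemiUpHomeo : ↥(hemiUp d) ≃ₜ Dd d where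
  toFun := hemiUpToDisc
  invFun := discToHemiUp
  left_inv p := by
    apply Subtype.ext; apply Subtype.ext
    change WithLp.toLp 2 (((p : SW d) : Wd d).fst, hgt (hemiUpToDisc p)) = ((p : SW d) : Wd d)
    rw [← snd_eq_hgt_of_mem_hemiUp p]; rfl
  right_inv v := by apply Subtype.ext; rfl
  continuous_toFun := hemiUpToDisc.continuous
  continuous_invFun := discToHemiUp.continuous

/-- **`D₋ ≃ₜ Dᵈ`.** [folklore] -/
def hemiDnHomeo : ↥(hemiDn d) ≃ₜ Dd d where
  toFun := hemiDnToDisc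
  invFun := discToHemiDn
  left_inv p := by
    apply Subtype.ext; apply Subtype.ext
    change WithLp.toLp 2 (((p : SW d) : Wd d).fst, -hgt (hemiDnToDisc p)) = ((p : SW d) : Wd d)
    rw [← snd_eq_neg_hgt_of_mem_hemiDn p]; rfl
  right_inv v := by apply Subtype.ext; rfl
  continuous_toFun := hemiDnToDisc.continuous
  continuous_invFun := discToHemiDn.continuous

/-- Mapping cone of the Hopf construction (Hatcher VBKT §2.3). -/
instance contractibleSpace_disc : ContractibleSpace (Dd d) :=
  (convex_closedBall (0 : Vd d) 1).contractibleSpace ⟨0, mem_closedBall_self zero_le_one⟩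

/-- Mapping cone of the Hopf construction (Hatcher VBKT §2.3). -/
instance contractibleSpace_hemiUp : ContractibleSpace ↥(hemiUp d) := hemiUpHomeo.contractibleSpace

/-- Mapping cone of the Hopf construction (Hatcher VBKT §2.3). -/
instance contractibleSpace_hemiDn : ContractibleSpace ↥(hemiDn d) := hemiDnHomeo.contractibleSpace

/-- `j` restricted to a closed subset of the sphere is a homeomorphism onto its image. [folklore] -/
def coneJRestrictHomeo (T : Set (SW d)) (hT : IsClosed T) : ↥T ≃ₜ ↥(coneJ g e₀ '' T) :=
  haveI : CompactSpace ↥T := isCompact_iff_compactSpace.1 hT.isCompact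
  Continuous.homeoOfEquivCompactToT2
    (f := Equiv.ofBijective (fun p : ↥T ↦ (⟨coneJ g e₀ p, p, p.2, rfl⟩ : ↥(coneJ g e₀ '' T)))
      ⟨fun _ _ h ↦ Subtype.ext (coneJ_injective g e₀ (congrArg Subtype.val h)),
        fun ⟨_, p, hp, hc⟩ ↦ ⟨⟨p, hp⟩, Subtype.ext hc⟩⟩)
    (((coneJ g e₀).continuous.comp continuous_subtype_val).subtype_mk _)

/-- Mapping cone of the Hopf construction (Hatcher VBKT §2.3). -/
instance contractibleSpace_coneDup : ContractibleSpace ↥(coneDupC g e₀ : Set (Cone g e₀)) :=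
  (coneJRestrictHomeo g e₀ (hemiUp d) isClosed_hemiUp).symm.contractibleSpace

/-- Mapping cone of the Hopf construction (Hatcher VBKT §2.3). -/
instance contractibleSpace_coneDdn : ContractibleSpace ↥(coneDdnC g e₀ : Set (Cone g e₀)) :=
  (coneJRestrictHomeo g e₀ (hemiDn d) isClosed_hemiDn).symm.contractibleSpace

/-- The bottom sphere is homeomorphic to `Sᵈ` via `j`. [folklore] -/
def coneSHomeo : SW d ≃ₜ ↥(coneSC g e₀ : Set (Cone g e₀)) :=
  (Homeomorph.Set.univ (SW d)).symm.trans
    ((coneJRestrictHomeo g e₀ univ isClosed_univ).trans (Homeomorph.setCongr (by rw [image_univ]; rfl)))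

/-- Mapping cone of the Hopf construction (Hatcher VBKT §2.3). [folklore] -/
@[simp] theorem coe_coneSHomeo (p : SW d) : ((coneSHomeo g e₀ p : ↥(coneSC g e₀ : Set (Cone g e₀))) : Cone g e₀) = coneJ g e₀ p := rfl

end Hemispheres

/-! ### 7. Radial extension of a null-homotopy over the unit ball -/

section BallExt

variable {W' : Type*} [NormedAddCommGroup W'] [NormedSpace ℝ W'] {M : Type*} [TopologicalSpace M]

/-- Mapping cone of the Hopf construction (Hatcher VBKT §2.3). [folklore] -/
theorem norm_smul_inv_norm {u : W'} (hu : u ≠ 0) : ‖‖u‖⁻¹ • u‖ = 1 := by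
  rw [norm_smul, norm_inv, norm_norm, inv_mul_cancel₀ (norm_ne_zero_iff.2 hu)]

/-- The parameter `‖u‖ ∈ [0, 1]` of a point of the unit ball. [folklore] -/
def ballParam (u : ↥(closedBall (0 : W') 1)) : unitInterval := ⟨‖(u : W')‖, norm_nonneg _, mem_closedBall_zero_iff.1 u.2⟩

omit [NormedSpace ℝ W'] in
/-- Mapping cone of the Hopf construction (Hatcher VBKT §2.3). [folklore] -/
theorem continuous_ballParam : Continuous (ballParam : ↥(closedBall (0 : W') 1) → unitInterval) :=
  (continuous_norm.comp continuous_subtype_val).subtype_mk _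

omit [NormedSpace ℝ W'] in
/-- Mapping cone of the Hopf construction (Hatcher VBKT §2.3). [folklore] -/
@[simp] theorem coe_ballParam (u : ↥(closedBall (0 : W') 1)) : (ballParam u : ℝ) = ‖(u : W')‖ := rfl

/-- **Radial extension of a null-homotopy over the unit ball**: `u ↦ H(u/|u|, |u|)` (and the
common value `m₀ = H(·, 0)` at the centre). [cite: HatcherAT2002, Ch. 0] -/
def ballExt (H : C(↥(sphere (0 : W') 1) × unitInterval, M)) (m₀ : M) (u : ↥(closedBall (0 : W') 1)) : M :=
  haveI := Classical.dec ((u : W') = 0)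
  if hu : (u : W') = 0 then m₀
  else H (⟨‖(u : W')‖⁻¹ • (u : W'), mem_sphere_zero_iff_norm.2 (norm_smul_inv_norm hu)⟩, ballParam u)

/-- Mapping cone of the Hopf construction (Hatcher VBKT §2.3). [folklore] -/
theorem ballExt_of_ne_zero (H : C(↥(sphere (0 : W') 1) × unitInterval, M)) (m₀ : M) {u : ↥(closedBall (0 : W') 1)} (hu : (u : W') ≠ 0) :
    ballExt H m₀ u = H (⟨‖(u : W')‖⁻¹ • (u : W'), mem_sphere_zero_iff_norm.2 (norm_smul_inv_norm hu)⟩, ballParam u) := by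
  rw [ballExt, dif_neg hu]

/-- On the boundary sphere the radial extension is `H(·, 1)`. [folklore] -/
theorem ballExt_of_norm_eq_one (H : C(↥(sphere (0 : W') 1) × unitInterval, M)) (m₀ : M) {u : ↥(closedBall (0 : W') 1)}
    (hu : ‖(u : W')‖ = 1) : ballExt H m₀ u = H (⟨(u : W'), mem_sphere_zero_iff_norm.2 hu⟩, 1) := by
  have hu0 : (u : W') ≠ 0 := fun h ↦ by rw [h, norm_zero] at hu; exact zero_ne_one hu
  rw [ballExt_of_ne_zero H m₀ hu0]
  congr 1
  apply Prod.ext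
  · apply Subtype.ext; change ‖(u : W')‖⁻¹ • (u : W') = u; rw [hu, inv_one, one_smul]
  · apply Subtype.ext; change ‖(u : W')‖ = 1; exact hu

/-- **The radial extension of a null-homotopy is continuous** (at the centre by the tube lemma
over the compact sphere... or rather over the parameter space: `H(q, t) → m₀` uniformly in `q` as
`t → 0`). [cite: HatcherAT2002, Ch. 0] -/
theorem continuous_ballExt [ProperSpace W'] (H : C(↥(sphere (0 : W') 1) × unitInterval, M)) (m₀ : M) (hH : ∀ q, H (q, 0) = m₀) :
    Continuous (ballExt H m₀) := by
  rw [continuous_iff_continuousAt]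
  intro u
  by_cases hu : (u : W') = 0
  · -- at the centre: tube lemma
    rw [ContinuousAt, ballExt, dif_pos hu, tendsto_def]
    intro U hU
    have hev : ∀ᶠ t in 𝓝 (0 : unitInterval), ∀ q ∈ (univ : Set ↥(sphere (0 : W') 1)), H (q, t) ∈ U := by
      apply (isCompact_univ (X := ↥(sphere (0 : W') 1))).eventually_forall_of_forall_eventually
      intro q _
      have hc : ContinuousAt (fun z : unitInterval × ↥(sphere (0 : W') 1) ↦ H (z.2, z.1)) (0, q) :=
        (H.continuous.comp (continuous_snd.prodMk continuous_fst)).continuousAt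
      have hU' : U ∈ 𝓝 ((fun z : unitInterval × ↥(sphere (0 : W') 1) ↦ H (z.2, z.1)) (0, q)) := by
        change U ∈ 𝓝 (H (q, 0)); rwa [hH q]
      exact hc.preimage_mem_nhds hU'
    have hn : Tendsto (ballParam : ↥(closedBall (0 : W') 1) → unitInterval) (𝓝 u) (𝓝 0) := by
      have h0 : ballParam u = 0 := Subtype.ext (by rw [coe_ballParam, hu, norm_zero]; rfl)
      rw [← h0]; exact continuous_ballParam.tendsto u
    filter_upwards [hn.eventually hev] with v hv
    change ballExt H m₀ v ∈ U
    by_cases hv0 : (v : W') = 0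
    · rw [ballExt, dif_pos hv0]; exact mem_of_mem_nhds hU
    · rw [ballExt_of_ne_zero H m₀ hv0]; exact hv _ (mem_univ _)
  · -- away from the centre: a composition on the open set `{u ≠ 0}`
    have hopen : IsOpen {v : ↥(closedBall (0 : W') 1) | (v : W') ≠ 0} := isOpen_ne.preimage continuous_subtype_val
    have hcont : ContinuousOn (ballExt H m₀) {v : ↥(closedBall (0 : W') 1) | (v : W') ≠ 0} := by
      rw [continuousOn_iff_continuous_restrict]
      have heq : ({v : ↥(closedBall (0 : W') 1) | (v : W') ≠ 0}).restrict (ballExt H m₀) =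
          fun v : ↥{v : ↥(closedBall (0 : W') 1) | (v : W') ≠ 0} ↦
            H (⟨‖((v : ↥(closedBall (0 : W') 1)) : W')‖⁻¹ • ((v : ↥(closedBall (0 : W') 1)) : W'),
              mem_sphere_zero_iff_norm.2 (norm_smul_inv_norm v.2)⟩, ballParam (v : ↥(closedBall (0 : W') 1))) := by
        funext v; exact ballExt_of_ne_zero H m₀ v.2
      rw [heq]
      refine H.continuous.comp (Continuous.prodMk ?_ (continuous_ballParam.comp continuous_subtype_val))
      refine Continuous.subtype_mk ?_ _
      have h1 : Continuous fun v : ↥{v : ↥(closedBall (0 : W') 1) | (v : W') ≠ 0} ↦ ((v : ↥(closedBall (0 : W') 1)) : W') :=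
        continuous_subtype_val.comp continuous_subtype_val
      exact ((continuous_norm.comp h1).inv₀ (fun v ↦ norm_ne_zero_iff.2 v.2)).smul h1
    exact hcont.continuousAt (hopen.mem_nhds hu)

/-- The radial extension as a continuous map. [cite: HatcherAT2002, Ch. 0] -/
def ballExtMap [ProperSpace W'] (H : C(↥(sphere (0 : W') 1) × unitInterval, M)) (m₀ : M) (hH : ∀ q, H (q, 0) = m₀) :
    C(↥(closedBall (0 : W') 1), M) := ⟨ballExt H m₀, continuous_ballExt H m₀ hH⟩

/-- Mapping cone of the Hopf construction (Hatcher VBKT §2.3). [folklore] -/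
@[simp] theorem ballExtMap_apply [ProperSpace W'] (H : C(↥(sphere (0 : W') 1) × unitInterval, M)) (m₀ : M) (hH) (u) :
    ballExtMap H m₀ hH u = ballExt H m₀ u := rfl

end BallExt

end Literature.AlgebraicTopology.KTheory

end
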